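import Summits.QuantumFields.YangMills.Theorems.LuscherReductionRunningReductionPolyakovLine
import Summits.QuantumFields.YangMills.Theorems.FlatTubeReductionOffTubeSuppressionPrelim
import Summits.QuantumFields.YangMills.Theorems.FemtoTransferGapSlab
import Literature.MathematicalPhysics.QuantumFieldTheory.TorusLoopReflection
import HarnessLib

/-!
# Polyakov pinning near the twisted pure-gauge orbits, and the tube maximiser dominates the first min–max level
# (crux K1b `ValleyRelocalisation` of route `FlatTubeReduction`, item stmt-QuantumFields-25191; rung R2b1 = RECORD-label femto gap)

Seat `ym-line-ftr-p1` g2 (prover).  Two conversion lemmas between the currencies of RED's fixed-lattice programme (orbit distance `orbitDist`,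
composite twists `TT.twist3`, Polyakov lines `lineProd`) and the currency of the route decl `FlatTubeReduction.ValleyRelocalisation`
(Polyakov holonomies `polyakovSite`, pinning threshold `2 − |Re tr P|`, Rayleigh maximisers over tube states):

* §1 `lineProd_eq_lineHolonomy` — RED's partial Polyakov line IS the tree's `lineHolonomy` (same ordered product); hence
  ★ `two_sub_abs_re_trace_polyakovSite_le` — if some twisted copy `twist3 z U` is within orbit distance `r` of the pure gauges, then EVERY
  Polyakov holonomy of `U` is pinned to the centre: `2 − |Re tr P_e(x)(U)| ≤ (L·r)²/2` (RED's `re_trace_lineProd_ge_of_orbitDist_lt` + the sign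
  `centreElem (z k)` picked up by the closed line, `lineProd_twist3_closed`).  So the INNER piece `cos Θ_δ · ψ` of RED's onion partition is
  Polyakov-pinned at threshold `(Lδ)²/2`.
* §2 ★ `qform_le_of_tubeMax` / `levelValue_one_le_of_tubeMax` — if `ψ` (with `‖ψ‖² > 0`) maximises the Rayleigh quotient over tube-supported
  physical states `⊥ Ω` and every physical `f ⊥ Ω` can be truncated to the tube at cost `s·λ₀‖f‖²` (the shape of the PROVED crux K2
  `OffTubeSuppression`), then `⟨f,K_βf⟩ ≤ (R(ψ) + sλ₀)‖f‖²` for all physical `f ⊥ Ω`, and `λ₁ = levelValue su2Rep L β 1 ≤ R(ψ) + sλ₀`.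

HONEST FRAMING: bookkeeping; nothing here concerns infinite volume, the continuum, or the Clay Yang–Mills mass gap.  No definitions, no named
facts, no `sorry`.
-/

set_option autoImplicit false

noncomputable section

open MeasureTheory Filter Topology Real
open scoped Matrix
open Literature.MathematicalPhysics.QuantumFieldTheory
open Literature.MathematicalPhysics.QuantumLattice

namespace Summit.QuantumFields.YangMills.Theorems.FemtoTransferGap

namespace ValleyReloc

open Summit.QuantumFields.YangMills.Theorems.FemtoTransferGap.OffTube

variable {L : ℕ} [NeZero L]

/-! ## §1 Polyakov pinning near the twisted pure-gauge orbits -/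

omit [NeZero L] in
/-- RED's partial Polyakov line `lineProd U x k n` is the tree's `lineHolonomy U k n x` (both are `U(x,k)U(x+ê_k,k)⋯U(x+(n−1)ê_k,k)`). [folklore] -/
theorem lineProd_eq_lineHolonomy (U : GaugeConfig 3 L SU2) (x : Site 3 L) (k : Fin 3) :
    ∀ n : ℕ, lineProd U x k n = lineHolonomy U k n x
  | 0 => by rw [lineProd_zero, lineHolonomy_zero]
  | n + 1 => by rw [lineProd_succ, lineHolonomy_succ_right, lineProd_eq_lineHolonomy U x k n]

omit [NeZero L] in
/-- The Polyakov holonomy read by the route decl is RED's closed line: `su2Rep (polyakovSite x U e) = lineProd U x e.2 L` as a matrix. [folklore] -/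
theorem su2Rep_polyakovSite (U : GaugeConfig 3 L SU2) (x : Site 3 L) (e : Edge 3 1) :
    su2Rep (polyakovSite x U e) = ((lineProd U x e.2 L : SU2) : Matrix (Fin 2) (Fin 2) ℂ) := by
  rw [fundamentalRep_apply, lineProd_eq_lineHolonomy]
  rfl

/-- ★ **Pinning near a twisted pure-gauge orbit.**  If `orbitDist (twist3 z U) < r` for some composite twist `z`, then every Polyakov holonomy
of `U` satisfies `2 − |Re tr P_e(x)(U)| ≤ (L·r)²/2`. [cite: tHooft1979] [cite: Luscher1983, §2] -/
theorem two_sub_abs_re_trace_polyakovSite_le {U : GaugeConfig 3 L SU2} {r : ℝ} (z : Fin 3 → Bool)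
    (hU : orbitDist (TT.twist3 z U) < r) (x : Site 3 L) (e : Edge 3 1) :
    2 - |((su2Rep (polyakovSite x U e)).trace).re| ≤ ((L : ℝ) * r) ^ 2 / 2 := by
  have h := re_trace_lineProd_ge_of_orbitDist_lt hU x e.2
  rw [su2Rep_polyakovSite]
  cases hz : z e.2
  · -- no sign: the twisted line equals the line
    have e1 : lineProd (TT.twist3 z U) x e.2 L = lineProd U x e.2 L := by
      rw [lineProd_twist3_closed, hz]
      simp [TT.centreElem]
    rw [e1] at h
    linarith [le_abs_self ((((lineProd U x e.2 L : SU2) : Matrix (Fin 2) (Fin 2) ℂ).trace).re)]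
  · -- sign flip
    rw [re_trace_lineProd_twist3_true hz U x] at h
    linarith [neg_le_abs ((((lineProd U x e.2 L : SU2) : Matrix (Fin 2) (Fin 2) ℂ).trace).re)]

/-- ★ Contrapositive in the route decl's shape: near some twisted orbit (`orbitDist (twist3 z U) < r`) and `(L·r)²/2 ≤ c`, NO Polyakov holonomy
is `c`-far from the centre. [folklore] -/
theorem not_unpinned_of_orbitDist_twist3_lt {U : GaugeConfig 3 L SU2} {r c : ℝ} (z : Fin 3 → Bool)
    (hU : orbitDist (TT.twist3 z U) < r) (hc : ((L : ℝ) * r) ^ 2 / 2 ≤ c) :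
    ¬ ∃ (x : Site 3 L) (e : Edge 3 1), c < 2 - |((su2Rep (polyakovSite x U e)).trace).re| := by
  rintro ⟨x, e, hxe⟩
  have h := two_sub_abs_re_trace_polyakovSite_le z hU x e
  linarith

/-! ## §2 The tube maximiser dominates the first min–max level -/

/-- ★ **Domination by the tube maximiser.**  `β ≥ 0`; `Ω` physical; `ψ` physical with `‖ψ‖² > 0` maximising the Rayleigh quotient over
tube-supported (`ψ = 0` where `η < S`) physical states `⊥ Ω` (cross-multiplied form); every physical `f ⊥ Ω` admits a tube-supported physical
`f' ⊥ Ω` with `‖f'‖² ≤ ‖f‖²` and `⟨f,Kf⟩ ≤ ⟨f',Kf'⟩ + sλ₀‖f‖²` (`s ≥ 0`).  Then `⟨f,K_βf⟩ ≤ (R(ψ) + sλ₀)‖f‖²` for every physical `f ⊥ Ω`.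
[cite: ReedSimonIV1978, Thm. XIII.1] -/
theorem qform_le_of_tubeMax {β : ℝ} (hβ : 0 ≤ β) {η s : ℝ} {Ω ψ : GaugeConfig 3 L SU2 → ℝ} (hψ : IsPhys ψ)
    (hψpos : 0 < l2 ψ ψ)
    (hmax : ∀ φ : GaugeConfig 3 L SU2 → ℝ, IsPhys φ → l2 φ Ω = 0 → (∀ U, η < wilsonAction su2Rep U → φ U = 0) →
      qform su2Rep β φ φ * l2 ψ ψ ≤ qform su2Rep β ψ ψ * l2 φ φ)
    (hK2 : ∀ f : GaugeConfig 3 L SU2 → ℝ, IsPhys f → l2 f Ω = 0 → ∃ f' : GaugeConfig 3 L SU2 → ℝ, IsPhys f' ∧ l2 f' Ω = 0 ∧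
      (∀ U, η < wilsonAction su2Rep U → f' U = 0) ∧ l2 f' f' ≤ l2 f f ∧
      qform su2Rep β f f ≤ qform su2Rep β f' f' + s * topValue su2Rep L β * l2 f f)
    {f : GaugeConfig 3 L SU2 → ℝ} (hf : IsPhys f) (hfΩ : l2 f Ω = 0) :
    qform su2Rep β f f ≤ (qform su2Rep β ψ ψ / l2 ψ ψ + s * topValue su2Rep L β) * l2 f f := by
  obtain ⟨f', hf', hf'Ω, hsupp, hle, hq⟩ := hK2 f hf hfΩ
  set R : ℝ := qform su2Rep β ψ ψ / l2 ψ ψ with hR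
  have hR0 : 0 ≤ R := div_nonneg (qform_su2Rep_self_nonneg hβ hψ) hψpos.le
  have h1 : qform su2Rep β f' f' ≤ R * l2 f' f' := by
    have h := hmax f' hf' hf'Ω hsupp
    rw [hR, div_mul_eq_mul_div, le_div_iff₀ hψpos]
    linarith
  have h2 : R * l2 f' f' ≤ R * l2 f f := mul_le_mul_of_nonneg_left hle hR0
  calc qform su2Rep β f f ≤ qform su2Rep β f' f' + s * topValue su2Rep L β * l2 f f := hq
    _ ≤ R * l2 f f + s * topValue su2Rep L β * l2 f f := by linarith
    _ = (R + s * topValue su2Rep L β) * l2 f f := by ring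

/-- ★ **Hence the first min–max level is dominated**: `levelValue su2Rep L β 1 ≤ R(ψ) + sλ₀` (min–max at the constraint `φ = Ω`).
[cite: ReedSimonIV1978, Thm. XIII.1] -/
theorem levelValue_one_le_of_tubeMax {β : ℝ} (hβ : 0 ≤ β) {η s : ℝ} (hs : 0 ≤ s) {Ω ψ : GaugeConfig 3 L SU2 → ℝ} (hΩ : IsPhys Ω)
    (hψ : IsPhys ψ) (hψpos : 0 < l2 ψ ψ)
    (hmax : ∀ φ : GaugeConfig 3 L SU2 → ℝ, IsPhys φ → l2 φ Ω = 0 → (∀ U, η < wilsonAction su2Rep U → φ U = 0) →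
      qform su2Rep β φ φ * l2 ψ ψ ≤ qform su2Rep β ψ ψ * l2 φ φ)
    (hK2 : ∀ f : GaugeConfig 3 L SU2 → ℝ, IsPhys f → l2 f Ω = 0 → ∃ f' : GaugeConfig 3 L SU2 → ℝ, IsPhys f' ∧ l2 f' Ω = 0 ∧
      (∀ U, η < wilsonAction su2Rep U → f' U = 0) ∧ l2 f' f' ≤ l2 f f ∧
      qform su2Rep β f f ≤ qform su2Rep β f' f' + s * topValue su2Rep L β * l2 f f) :
    levelValue su2Rep L β 1 ≤ qform su2Rep β ψ ψ / l2 ψ ψ + s * topValue su2Rep L β := by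
  set X : ℝ := qform su2Rep β ψ ψ / l2 ψ ψ + s * topValue su2Rep L β with hX
  have hX0 : 0 ≤ X :=
    add_nonneg (div_nonneg (qform_su2Rep_self_nonneg hβ hψ) hψpos.le) (mul_nonneg hs (topValue_su2Rep_pos L β).le)
  have hS : sSup (rayleighSet su2Rep L β fun φ => l2 φ Ω = 0) ≤ X := by
    apply Real.sSup_le _ hX0
    rintro r ⟨f, hf, hfΩ, hpos, rfl⟩
    rw [div_le_iff₀ hpos]
    exact qform_le_of_tubeMax hβ hψ hψpos hmax hK2 hf hfΩ
  rw [levelValue_one]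
  refine le_trans (csInf_le ?_ ⟨Ω, hΩ, rfl⟩) hS
  refine ⟨0, ?_⟩
  rintro t ⟨φ, -, rfl⟩
  exact Real.sSup_nonneg fun r hr => rayleigh_nonneg_fundamentalRep hβ hr

end ValleyReloc

end Summit.QuantumFields.YangMills.Theorems.FemtoTransferGap

end
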